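import Summits.ResolutionOfSingularities.ResolutionOfSingularities.Theorems.HomologicalConductorNoZenoRGlobalResolutionBlowup
import Literature.AlgebraicGeometry.Resolution.ExceptionalCurvesLocalizedResolution
import Literature.AlgebraicGeometry.Resolution.MarkedIdealsEtale
import Literature.AlgebraicGeometry.Resolution.NonPrincipalLocus
import Literature.AlgebraicGeometry.Resolution.ArithmeticalThreefoldsBlowupFormDimThree
import HarnessLib

/-!
# Crux `NoZenoR` (stmt-ResolutionOfSingularities-19943) — toward the W3 print `Lipman1969_4_1`:
# MINIMALITY GLOBALISES — if the local minimal desingularizations are blowing ups of `𝔪`-primary ideals, the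
# blowing up of their product ideal is a GLOBAL MINIMAL desingularization

Route `ResolutionOfSingularities/HomologicalConductor` (cell decomp-res, hand leafhand-res-homologicalconduct-16 g4).
OURS: AI-written, weaker than expert review; SUPPORT level, counted 0; def-free, fact-free (no named fact is used).
Nothing here is a statement of the manuscript under review (Hironaka 2017); no crux / summit statement is proved.

THE MATHEMATICS (folklore, print-free), continuing `…NoZenoRGlobalResolutionBlowup`.  Let `Y` be integral Noetherian, `Z ⊆ Y` a
finite set of closed points off the generic point containing `Y ∖ Reg Y`, and suppose that for every `y ∈ Z` the local scheme
`Spec 𝒪_{Y,y}` has a MINIMAL desingularization (`IsMinimalResolution`: every desingularization factors through it) which is a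
blowing up along an ideal sheaf cosupported at the closed point.  Then `Y` has a MINIMAL desingularization, namely the blowing up
`f : X = Bl_J(Y) → Y` of the companion file (`J = ∏ J_y`, `ι_y⁻¹J 𝒪 = I_y`).  Factorisation of a desingularization `g : W → Y`
through `f`: by the universal property of the blowing up it suffices that `J · 𝒪_W` be an effective Cartier ideal; `W` being
integral and `J · 𝒪_W ≠ 0` (the generic point of `W` maps off `Z ⊇ V(J)`), it suffices that `J · 𝒪_W` be locally principal
(`IsLocallyPrincipal.isEffectiveCartier_of_ne_bot`); off `g⁻¹Z` it is the unit ideal; at `w` over `y ∈ Z`, base change to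
`Spec 𝒪_{Y,y}`: `W_y = W ×_Y Spec 𝒪_{Y,y} → Spec 𝒪_{Y,y}` is a desingularization (`IsResolution.pullback_snd_fromSpecStalk`), so
factors through the local minimal one `ρ_y : X_y → Spec 𝒪_{Y,y}`, a blowing up along `I_y`; hence
`(J𝒪_W)·𝒪_{W_y} = I_y · 𝒪_{W_y}` is pulled back from the invertible `I_y 𝒪_{X_y}`, so its stalks are principal; and the stalks
of `W_y` are the stalks of `W` at the points over `y` (`isIso_stalkMap_pullback_fst_fromSpecStalk`), so `(J𝒪_W)_w` is principal
(`stalkIdeal_comap_eq_map`, `isLocallyPrincipalAt_iff_isPrincipal_stalkIdeal`).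

* `isPrincipal_of_map_bijective` — algebra: an ideal whose extension along a ring isomorphism is principal is principal;
* `isPrincipal_stalkIdeal_comap_of_isPrincipal` — principal stalks pull back to principal stalks along any morphism;
* `exists_isMinimalResolution_isBlowup_of_local` — MAIN.

What this isolates for the print `Lipman1969_4_1` (minimal desingularization of a normal surface with finitely many rational
singularities): GIVEN the tree's local minimal desingularization of a rational `Spec 𝒪_{Y,y}` (`exists_isMinimalResolution_of_27_1`,
modulo `Lipman1969_27_1_reg_rat`), the ONLY missing input is LOCAL: «the minimal desingularization of `Spec 𝒪_{Y,y}` is a blowing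
up of an `𝔪_y`-primary ideal» (Lipman 1969 §6–§7 / Cor. (27.2): complete ideals, projectivity) — the global gluing needs no
EGA IV §8 spreading.
-/

noncomputable section

-- single-problem summit: the doubled namespace component `ResolutionOfSingularities` is forced
set_option linter.dupNamespace false

open CategoryTheory CategoryTheory.Limits AlgebraicGeometry TopologicalSpace IsLocalRing
open Literature.AlgebraicGeometry.Resolution

universe u

namespace Summit.ResolutionOfSingularities.ResolutionOfSingularities.Theorems.NoZeno.GlobalResolution

/-! ## Principal stalks -/

/-- An ideal whose extension along a bijective ring homomorphism is principal is principal. [folklore] -/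
theorem isPrincipal_of_map_bijective {A B : Type*} [CommRing A] [CommRing B] (e : A →+* B)
    (he : Function.Bijective e) (I : Ideal A) (h : (I.map e).IsPrincipal) : I.IsPrincipal := by
  obtain ⟨b, hb⟩ := h
  obtain ⟨a, rfl⟩ := he.2 b
  refine ⟨a, ?_⟩
  rw [← Ideal.comap_map_of_bijective e he (I := I), hb]
  ext x
  simp only [Ideal.submodule_span_eq, Ideal.mem_comap, Ideal.mem_span_singleton']
  constructor
  · rintro ⟨c, hc⟩
    obtain ⟨c', rfl⟩ := he.2 c
    exact ⟨c', he.1 (by rw [map_mul, hc])⟩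
  · rintro ⟨c, rfl⟩
    exact ⟨e c, by rw [map_mul]⟩

/-- **Principal stalks pull back to principal stalks**: `(K·𝒪_{X'})_{x'} = K_{φ x'} · 𝒪_{X',x'}` is principal if `K_{φ x'}` is.
[folklore] -/
theorem isPrincipal_stalkIdeal_comap_of_isPrincipal {X' X : Scheme.{u}} (φ : X' ⟶ X) (K : X.IdealSheafData) (x' : X')
    (h : (stalkIdeal K (φ x')).IsPrincipal) : (stalkIdeal (K.comap φ) x').IsPrincipal := by
  obtain ⟨a, ha⟩ := h
  refine ⟨(φ.stalkMap x').hom a, ?_⟩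
  rw [stalkIdeal_comap_eq_map, ha, Ideal.submodule_span_eq, Ideal.map_span, Set.image_singleton,
    Ideal.submodule_span_eq]

/-- Principal stalks DESCEND along a morphism with bijective stalk map at the point. [folklore] -/
theorem isPrincipal_stalkIdeal_of_comap_of_isIso_stalkMap {X' X : Scheme.{u}} (φ : X' ⟶ X) (K : X.IdealSheafData)
    (x' : X') [IsIso (φ.stalkMap x')] (h : (stalkIdeal (K.comap φ) x').IsPrincipal) :
    (stalkIdeal K (φ x')).IsPrincipal := by
  rw [stalkIdeal_comap_eq_map] at h
  exact isPrincipal_of_map_bijective _ (ConcreteCategory.bijective_of_isIso (φ.stalkMap x')) _ h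

/-! ## The global minimal desingularization -/

/-- **Minimality globalises** (integral Noetherian `Y`; `Z` a finite set of closed points off the generic point containing every
non-regular point; for each `y ∈ Z` a MINIMAL desingularization of `Spec 𝒪_{Y,y}` which is a blowing up along an ideal sheaf
cosupported at the closed point): `Y` has a minimal desingularization (`IsMinimalResolution`: a desingularization through which
every desingularization of `Y` factors), which is a blowing up along an ideal sheaf `J` with `V(J) ⊆ Z`.  Module docstring.
[this work] -/
theorem exists_isMinimalResolution_isBlowup_of_local {Y : Scheme.{u}} [IsIntegral Y] [IsNoetherian Y]
    (Z : Set Y) (hZf : Z.Finite) (hZc : ∀ y ∈ Z, IsClosed ({y} : Set Y)) (hgen : genericPoint Y ∉ Z)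
    (hreg : ∀ y : Y, y ∉ Z → y ∈ Scheme.regularLocus Y)
    (hloc : ∀ y ∈ Z, ∃ (Xy : Scheme.{u}) (ρ : Xy ⟶ Spec (Y.presheaf.stalk y))
      (I : (Spec (Y.presheaf.stalk y)).IdealSheafData), IsMinimalResolution ρ ∧ IsBlowup ρ I ∧
        (I.support : Set (Spec (Y.presheaf.stalk y))) ⊆ {closedPoint (Y.presheaf.stalk y)}) :
    ∃ (X : Scheme.{u}) (f : X ⟶ Y) (J : Y.IdealSheafData),
      IsMinimalResolution f ∧ IsBlowup f J ∧ (J.support : Set Y) ⊆ Z := by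
  classical
  -- the global ideal sheaf (steps 1–2 of the companion file)
  have key : ∀ y ∈ Z, ∃ (Jy : Y.IdealSheafData), ((Jy.support : Set Y) ⊆ {y}) ∧
      ∃ (Xy : Scheme.{u}) (ρ : Xy ⟶ Spec (Y.presheaf.stalk y)),
        IsMinimalResolution ρ ∧ IsBlowup ρ (Jy.comap (Y.fromSpecStalk y)) := by
    intro y hy
    obtain ⟨Xy, ρ, I, hρ, hρI, hI⟩ := hloc y hy
    obtain ⟨Jy, hJy, hsupp⟩ := exists_comap_fromSpecStalk_eq y (hZc y hy) I hI
    exact ⟨Jy, hsupp, Xy, ρ, hρ, by rw [hJy]; exact hρI⟩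
  choose! Jf hJsupp Xf ρf hρ hρJ using key
  let T : Finset Y := hZf.toFinset
  have hTZ : ∀ y, y ∈ T ↔ y ∈ Z := fun y => Set.Finite.mem_toFinset hZf
  obtain ⟨hJ1, hJ2, -⟩ := prod_support_subset_and_comap Jf T (fun y hy => hZc y ((hTZ y).mp hy))
    (fun y hy => hJsupp y ((hTZ y).mp hy))
  let J : Y.IdealSheafData := ∏ y ∈ T, Jf y
  have hJZ : (J.support : Set Y) ⊆ Z := fun x hx => (hTZ x).mp (Finset.mem_coe.mp (hJ1 hx))
  -- the blowing up (step 3 of the companion file)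
  obtain ⟨X, f, hf⟩ := exists_isBlowup Y J
  have hJ0 : J ≠ ⊥ := by
    intro h
    apply hgen
    apply hJZ
    rw [h, Scheme.IdealSheafData.support_bot]
    trivial
  haveI : IsIntegral X := hf.isIntegral hJ0
  haveI : IsProper f := hf.isProper
  have hres : IsResolution f := by
    refine ⟨inferInstance, hf.isBirational' hJ0, fun x => ?_⟩
    by_cases hx : f x ∈ Z
    · set y := f x with hy_def
      haveI : Flat (Y.fromSpecStalk y) := flat_fromSpecStalk Y y
      have hb : IsBlowup (pullback.snd f (Y.fromSpecStalk y)) ((Jf y).comap (Y.fromSpecStalk y)) := by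
        rw [← hJ2 y ((hTZ y).mpr hx)]
        exact hf.pullback_snd_of_flat (Y.fromSpecStalk y)
      obtain ⟨e, -, -⟩ := hb.unique (hρJ y hx)
      have hregP : Scheme.IsRegular (pullback f (Y.fromSpecStalk y)) :=
        Scheme.IsRegular.of_iso e.inv (hρ y hx).1.isRegular
      obtain ⟨s, hs⟩ := mem_range_pullback_fst_fromSpecStalk_of_eq f y (x' := x) rfl
      have := (mem_regularLocus_iff_pullback_fst_fromSpecStalk f y s).mp (hregP s)
      rw [hs] at this
      exact this
    · haveI := hf.isIso_compl
      have hxU : f x ∈ (⟨(J.support : Set Y)ᶜ, J.support.isClosed.isOpen_compl⟩ : Y.Opens) :=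
        fun h => hx (hJZ h)
      exact (mem_regularLocus_iff_of_isIso_morphismRestrict f _ x hxU).mpr (hreg (f x) hx)
  refine ⟨X, f, J, ⟨hres, fun W g hg => ?_⟩, hf, hJZ⟩
  -- MINIMALITY: a desingularization `g : W → Y` factors through `f` — `J·𝒪_W` is an effective Cartier ideal
  haveI : IsProper g := hg.isProper
  haveI : IsIntegral W := hg.isIntegral_source
  haveI : IsNoetherian W := by
    haveI : IsLocallyNoetherian W := LocallyOfFiniteType.isLocallyNoetherian g
    haveI : CompactSpace W := QuasiCompact.compactSpace_of_compactSpace g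
    exact {}
  -- `J·𝒪_W ≠ 0`: the generic point of `W` maps to the generic point of `Y`, off `Z ⊇ V(J)`
  have hJg0 : J.comap g ≠ ⊥ := by
    intro h
    haveI : IsDominant g := hg.isBirational.isDominant
    have hgen' : g (genericPoint W) = genericPoint Y := by
      have h1 := (genericPoint_spec W).image g.continuous
      rw [Set.image_univ, g.denseRange.closure_range] at h1
      exact h1.eq (by simpa using genericPoint_spec Y)
    have hmem : genericPoint W ∈ ((J.comap g).support : Set W) := by
      rw [h, Scheme.IdealSheafData.support_bot]; trivial
    rw [Scheme.IdealSheafData.support_comap] at hmem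
    exact hgen (hJZ (by simpa [hgen'] using hmem))
  -- `J·𝒪_W` is locally principal
  have hLP : IsLocallyPrincipal (J.comap g) := by
    intro w
    by_cases hw : g w ∈ Z
    · set y := g w with hy_def
      haveI : Flat (Y.fromSpecStalk y) := flat_fromSpecStalk Y y
      -- base change of `g` to `Spec 𝒪_{Y,y}` is a desingularization, hence factors through the local minimal one
      have hgy : IsResolution (pullback.snd g (Y.fromSpecStalk y)) := hg.pullback_snd_fromSpecStalk y
      obtain ⟨k, hk⟩ := (hρ y hw).2 _ _ hgy
      haveI : IsProper (ρf y hw) := (hρ y hw).1.isProper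
      haveI : IsLocallyNoetherian (Xf y hw) := LocallyOfFiniteType.isLocallyNoetherian (ρf y hw)
      -- `w` is hit by `W_y → W`, with isomorphic local ring
      obtain ⟨s, hs⟩ := mem_range_pullback_fst_fromSpecStalk_of_eq g y (x' := w) rfl
      haveI := isIso_stalkMap_pullback_fst_fromSpecStalk g y s
      rw [isLocallyPrincipalAt_iff_isPrincipal_stalkIdeal, ← hs]
      refine isPrincipal_stalkIdeal_of_comap_of_isIso_stalkMap (pullback.fst g (Y.fromSpecStalk y)) (J.comap g) s ?_
      -- `(J𝒪_W)𝒪_{W_y} = (I_y 𝒪_{X_y}) 𝒪_{W_y}` along `k`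
      have hcomap : (J.comap g).comap (pullback.fst g (Y.fromSpecStalk y)) =
          (((Jf y).comap (Y.fromSpecStalk y)).comap (ρf y hw)).comap k := by
        rw [← Scheme.IdealSheafData.comap_comp, pullback.condition, Scheme.IdealSheafData.comap_comp,
          hJ2 y ((hTZ y).mpr hw), ← Scheme.IdealSheafData.comap_comp, ← Scheme.IdealSheafData.comap_comp, hk,
          Scheme.IdealSheafData.comap_comp]
      rw [hcomap]
      refine isPrincipal_stalkIdeal_comap_of_isPrincipal k _ s ?_
      exact (isLocallyPrincipalAt_iff_isPrincipal_stalkIdeal _ _).mp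
        ((hρJ y hw).isEffectiveCartier.isLocallyPrincipal (k s))
    · refine isLocallyPrincipalAt_of_not_mem_support fun h => hw (hJZ ?_)
      rw [Scheme.IdealSheafData.support_comap] at h
      exact h
  obtain ⟨k, hk, -⟩ := hf.universal g (hLP.isEffectiveCartier_of_ne_bot hJg0)
  exact ⟨k, hk⟩

end Summit.ResolutionOfSingularities.ResolutionOfSingularities.Theorems.NoZeno.GlobalResolution

end
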